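import Mathlib.Data.Finset.Card
import Mathlib.Data.Finset.Erase
import Mathlib.Algebra.BigOperators.Group.Finset.Piecewise
import Mathlib.Algebra.Order.BigOperators.Group.Finset
import Mathlib.Algebra.Group.Action.Defs
import HarnessLib
import Summits.Ventures.HSemireg.StarFamilyTriangleBudget

/-!
# Missing-slot face counts up the ladder — THEOREM HD6 and the n = 7 sieve step as kernel counting

Cell `pub-hsemireg`, widening group W5, seat w5-n7-1 (gen 11); files of record `widen/W5/HD6-w5n61.md` §2
(THEOREM HD6, hand ×3 across seats; §4′) and `widen/W5/N7-FEASIBILITY-w5n7.md` (N7F) §3.11 (d), §3.12 (d), §3.14. HONEST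
FRAMING: pure finite counting. The objects are the MISSING hub→deuce SLOTS `i ∈ M` of an ∅-class heavy core of
the (20,−8) ℚ(i) star family, each supported on the 2-element set `supp i = {x, y}` of the two coordinates it
involves (hub of `x`, a deuce of `y`); the slots of the face `S ∖ z` are the slots supported inside `S.erase z`.
The MACHINE / HAND facts of record enter as hypotheses on face counts: THEOREM ∅⁵ «every five-coordinate face
misses ≥ 2 slots» (N7F §3.11 (b): STEP 1 typed in `StarFamilyFaceSumBinomial`, STEP 1′ in
`StarFamilyHDDefectSystems.defectOne_false`), LEMMA M7 «a five-face missing EXACTLY two slots misses two slots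
that share a coordinate» (`StarFamilyHDDefectSystems.typeDisjoint_false`), THEOREM HD6 itself for the n = 7
steps. What is kernel-checked:

* `sum_card_filter_supp_subset_erase` — the support-weighted FACE SUM IDENTITY
  `∑_{z ∈ S} #{slots inside S.erase z} = (#S − 2) · #{slots inside S}` is, in this v3, the tree's
  `StarFamilyTriangleBudget.sum_card_filter_supp_subset_erase` (ladder k = 314), IMPORTED and opened rather than
  restated; `sum_card_filter_mem_supp` — its complement `∑_{z ∈ S} #{slots inside S through z} =
  2 · #{slots inside S}`.
* `card_mul_le_of_cofaces` — «every co-face holds ≥ m slots ⇒ #S · m ≤ (#S − 2) · #{slots inside S}»;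
  `three_le_card_of_cofaces_two_le` (#S = 6, co-faces ≥ 2 ⇒ ≥ 3 slots) and `six_le_card_of_cofaces_four_le`
  (#S = 7, co-faces ≥ 4 ⇒ ≥ 6 slots: HD6's «5k ≥ 28»).
* `cofaces_eq_two_and_disjoint` — THEOREM HD6's equality step: #S = 6, co-faces ≥ 2 and exactly 3 slots ⇒
  every co-face holds EXACTLY 2 and the three slots have pairwise disjoint supports.
* `four_le_card_of_cofaces` — **THEOREM HD6** as a composition: #S = 6, co-faces ≥ 2 (THEOREM ∅⁵) and «a
  co-face with exactly two slots has two slots sharing a coordinate» (LEMMA M7) ⇒ ≥ 4 slots.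
* `touch_le_two_of_seven`, `five_le_card_touchedTwice` — N7F §3.12 (d)'s sieve step at n = 7: #S = 7, exactly 6
  slots, co-faces ≥ 4 ⇒ every coordinate lies in ≤ 2 slots and at least 5 coordinates lie in exactly 2.
* `four_le_card_of_cofaces_edge`, `cofaces_edge_eq_of_card_eq_four` — N7F §3.14's HEREDITY BOUND for the K₂ class
  at n = 7 (the slots are the missing hub→deuce slots OFF the hub–hub edge `{a, b}`): the two co-faces omitting an
  edge end miss ≥ 4 (THEOREM HD6, they are ∅-class), the five others miss ≥ 2 (HD6 §4′) ⇒ `5k ≥ 18`, `k ≥ 4`; and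
  `k = 4` forces both edge co-faces to miss exactly 4 (no slot touches the edge), every non-edge coordinate to lie in
  ≤ 2 slots, the five non-edge touch numbers to sum to 8, hence ≥ 3 of them equal to 2 (touch-vector (2,2,2,1,1) or
  (2,2,2,2,0)).

Nothing here is a statement about a variety, a sheaf or a Hodge class, and nothing here bears on
HC / HC_CM / HC_AV.
-/

open Finset

namespace Summit.Ventures.HSemireg.StarFamilySlotFaceCounts

open Summit.Ventures.HSemireg.StarFamilyTriangleBudget (filter_supp_subset_erase sum_card_filter_supp_subset_erase)

variable {ι V : Type*} [DecidableEq V]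

-- `filter_supp_subset_erase` and `sum_card_filter_supp_subset_erase` (the SUPPORT-WEIGHTED FACE SUM IDENTITY) are
-- the tree's `Summit.Ventures.HSemireg.StarFamilyTriangleBudget` lemmas (ladder k = 314), imported and opened above.

/-- The complementary double count: `∑_{z ∈ S} #{slots inside S through z} = 2 · #{slots inside S}` (each slot
inside `S` is counted at the two coordinates of its support). -/
theorem sum_card_filter_mem_supp (M : Finset ι) (supp : ι → Finset V)
    (hM : ∀ i ∈ M, (supp i).card = 2) (S : Finset V) :
    ∑ z ∈ S, #{i ∈ M | supp i ⊆ S ∧ z ∈ supp i} = 2 * #{i ∈ M | supp i ⊆ S} := by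
  calc ∑ z ∈ S, #{i ∈ M | supp i ⊆ S ∧ z ∈ supp i}
      = ∑ z ∈ S, ∑ i ∈ M with supp i ⊆ S, (if z ∈ supp i then 1 else 0) := by
        refine sum_congr rfl fun z _ => ?_
        rw [← filter_filter, card_filter]
    _ = ∑ i ∈ M with supp i ⊆ S, ∑ z ∈ S, (if z ∈ supp i then 1 else 0) := sum_comm
    _ = ∑ i ∈ M with supp i ⊆ S, 2 := by
        refine sum_congr rfl fun i hi => ?_
        rw [mem_filter] at hi
        rw [← card_filter, filter_mem_eq_inter, inter_eq_right.2 hi.2, hM i hi.1]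
    _ = 2 * #{i ∈ M | supp i ⊆ S} := by
        rw [sum_const, smul_eq_mul, mul_comm]

/-- If every co-face of `S` holds at least `m` slots then `#S · m ≤ (#S − 2) · #{slots inside S}`. -/
theorem card_mul_le_of_cofaces (M : Finset ι) (supp : ι → Finset V)
    (hM : ∀ i ∈ M, (supp i).card = 2) (S : Finset V) (m : ℕ)
    (h : ∀ z ∈ S, m ≤ #{i ∈ M | supp i ⊆ S.erase z}) :
    S.card * m ≤ (S.card - 2) * #{i ∈ M | supp i ⊆ S} := by
  rw [← sum_card_filter_supp_subset_erase M supp hM S]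
  exact card_nsmul_le_sum S _ m h |>.trans_eq' (by rw [smul_eq_mul])

/-- **THEOREM HD6, counting step** (HD6-w5n61 §2: «4k = Σ_z k_z ≥ 6·2 ⇒ k ≥ 3»). On a 6-face all of whose
co-faces miss at least two slots (THEOREM ∅⁵), at least three slots are missing. -/
theorem three_le_card_of_cofaces_two_le (M : Finset ι) (supp : ι → Finset V)
    (hM : ∀ i ∈ M, (supp i).card = 2) {S : Finset V} (hS : S.card = 6)
    (h2 : ∀ z ∈ S, 2 ≤ #{i ∈ M | supp i ⊆ S.erase z}) : 3 ≤ #{i ∈ M | supp i ⊆ S} := by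
  have := card_mul_le_of_cofaces M supp hM S 2 h2
  rw [hS] at this
  omega

/-- **THEOREM HD6, the n = 7 corollary** (HD6-w5n61 §2: «each slot in 5 of the 7 six-faces, each ≥ 4 ⇒ 5k ≥ 28 ⇒
k ≥ 6»; N7F §3.11). On a 7-face all of whose co-faces miss at least four slots (THEOREM HD6), at least six
slots are missing. -/
theorem six_le_card_of_cofaces_four_le (M : Finset ι) (supp : ι → Finset V)
    (hM : ∀ i ∈ M, (supp i).card = 2) {S : Finset V} (hS : S.card = 7)
    (h4 : ∀ z ∈ S, 4 ≤ #{i ∈ M | supp i ⊆ S.erase z}) : 6 ≤ #{i ∈ M | supp i ⊆ S} := by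
  have := card_mul_le_of_cofaces M supp hM S 4 h4
  rw [hS] at this
  omega

/-- **THEOREM HD6, equality step** (HD6-w5n61 §2: «if k = 3 then Σ_z k_z = 12 forces k_z = 2 for all six z; …
every coordinate is involved in exactly one slot»). On a 6-face whose co-faces each miss ≥ 2 slots and which
misses EXACTLY 3 slots, every co-face misses exactly 2, and the three slots have pairwise disjoint supports
(two slots sharing a coordinate `z` would leave the co-face `S.erase z` with at most one slot). -/
theorem cofaces_eq_two_and_disjoint (M : Finset ι) (supp : ι → Finset V)
    (hM : ∀ i ∈ M, (supp i).card = 2) {S : Finset V} (hS : S.card = 6)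
    (h2 : ∀ z ∈ S, 2 ≤ #{i ∈ M | supp i ⊆ S.erase z}) (h3 : #{i ∈ M | supp i ⊆ S} = 3) :
    (∀ z ∈ S, #{i ∈ M | supp i ⊆ S.erase z} = 2) ∧
      ∀ i ∈ M, ∀ j ∈ M, supp i ⊆ S → supp j ⊆ S → i ≠ j → Disjoint (supp i) (supp j) := by
  -- two slots inside `S` sharing the coordinate `z` leave at most one slot inside `S.erase z`
  have key : ∀ i ∈ M, ∀ j ∈ M, supp i ⊆ S → supp j ⊆ S → i ≠ j →
      ∀ z ∈ supp i, z ∈ supp j → #{l ∈ M | supp l ⊆ S.erase z} ≤ 1 := by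
    classical
    intro i hi j hj hiS hjS hij z hzi hzj
    have hsub : {l ∈ M | supp l ⊆ S.erase z} ⊆ ({l ∈ M | supp l ⊆ S}.erase i).erase j := by
      intro l hl
      rw [filter_supp_subset_erase, mem_filter] at hl
      simp only [mem_erase, mem_filter]
      refine ⟨?_, ?_, hl.1, hl.2.1⟩
      · rintro rfl
        exact hl.2.2 hzj
      · rintro rfl
        exact hl.2.2 hzi
    have hiI : i ∈ {l ∈ M | supp l ⊆ S} := mem_filter.2 ⟨hi, hiS⟩
    have hjI : j ∈ {l ∈ M | supp l ⊆ S}.erase i := mem_erase.2 ⟨hij.symm, mem_filter.2 ⟨hj, hjS⟩⟩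
    calc #{l ∈ M | supp l ⊆ S.erase z} ≤ #(({l ∈ M | supp l ⊆ S}.erase i).erase j) := card_le_card hsub
      _ = 1 := by rw [card_erase_of_mem hjI, card_erase_of_mem hiI, h3]
  refine ⟨?_, ?_⟩
  · -- Σ_z k_z = 4 · 3 = 12 = Σ_z 2 with k_z ≥ 2 termwise
    have hsum := sum_card_filter_supp_subset_erase M supp hM S
    rw [hS, h3] at hsum
    have hconst : ∑ z ∈ S, (2 : ℕ) = (6 - 2) * 3 := by rw [sum_const, smul_eq_mul, hS]
    rw [← hconst] at hsum
    exact fun z hz => ((sum_eq_sum_iff_of_le h2).1 hsum.symm z hz).symm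
  · intro i hi j hj hiS hjS hij
    rw [disjoint_left]
    intro z hzi hzj
    have h1 := key i hi j hj hiS hjS hij z hzi hzj
    have h2z := h2 z (hiS hzi)
    omega

/-- **THEOREM HD6** (HD6-w5n61 §2), as a composition. On a 6-face `S`: if every co-face misses at least two
slots (THEOREM ∅⁵ on the six five-faces) and no co-face misses exactly two slots with disjoint supports
(LEMMA M7: a five-coordinate ∅-class core missing exactly two slots misses two slots that SHARE a coordinate),
then `S` misses at least FOUR slots. Proof: three by counting; if exactly three, the equality step makes every
co-face miss exactly two pairwise-disjoint slots, contradicting M7 on any co-face. -/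
theorem four_le_card_of_cofaces (M : Finset ι) (supp : ι → Finset V)
    (hM : ∀ i ∈ M, (supp i).card = 2) {S : Finset V} (hS : S.card = 6)
    (h2 : ∀ z ∈ S, 2 ≤ #{i ∈ M | supp i ⊆ S.erase z})
    (hM7 : ∀ z ∈ S, #{i ∈ M | supp i ⊆ S.erase z} = 2 →
      ∃ i ∈ M, ∃ j ∈ M, supp i ⊆ S.erase z ∧ supp j ⊆ S.erase z ∧ i ≠ j ∧ ¬ Disjoint (supp i) (supp j)) :
    4 ≤ #{i ∈ M | supp i ⊆ S} := by
  have h3 := three_le_card_of_cofaces_two_le M supp hM hS h2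
  by_contra hlt
  have heq : #{i ∈ M | supp i ⊆ S} = 3 := by omega
  obtain ⟨hcof, hdisj⟩ := cofaces_eq_two_and_disjoint M supp hM hS h2 heq
  have hne : S.Nonempty := card_pos.1 (by rw [hS]; omega)
  obtain ⟨z, hz⟩ := hne
  obtain ⟨i, hi, j, hj, hiz, hjz, hij, hndisj⟩ := hM7 z hz (hcof z hz)
  exact hndisj (hdisj i hi j hj (hiz.trans (erase_subset z S)) (hjz.trans (erase_subset z S)) hij)

/-- **N7F §3.12 (d), sieve step (i).** On a 7-face missing exactly 6 slots all of whose co-faces miss ≥ 4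
(THEOREM HD6), every coordinate lies in the support of at most 2 of the slots (`i_z = 6 − k_z ≤ 2`). -/
theorem touch_le_two_of_seven (M : Finset ι) (supp : ι → Finset V) {S : Finset V}
    (h6 : #{i ∈ M | supp i ⊆ S} = 6) (h4 : ∀ z ∈ S, 4 ≤ #{i ∈ M | supp i ⊆ S.erase z}) :
    ∀ z ∈ S, #{i ∈ M | supp i ⊆ S ∧ z ∈ supp i} ≤ 2 := by
  intro z hz
  have hsplit := card_filter_add_card_filter_not (s := {i ∈ M | supp i ⊆ S}) (fun i => z ∈ supp i)
  rw [filter_filter, filter_filter, h6] at hsplit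
  have h4z := h4 z hz
  rw [filter_supp_subset_erase] at h4z
  omega

/-- **N7F §3.12 (d), sieve step (ii)** («Σ i_z = 12, so ≥ 5 coordinates have i_z = 2»). On a 7-face missing
exactly 6 slots all of whose co-faces miss ≥ 4, at least FIVE of the seven coordinates lie in the support of
exactly 2 slots (the supports count `2 · 6 = 12` incidences over 7 coordinates, each ≤ 2). -/
theorem five_le_card_touchedTwice (M : Finset ι) (supp : ι → Finset V)
    (hM : ∀ i ∈ M, (supp i).card = 2) {S : Finset V} (hS : S.card = 7)
    (h6 : #{i ∈ M | supp i ⊆ S} = 6) (h4 : ∀ z ∈ S, 4 ≤ #{i ∈ M | supp i ⊆ S.erase z}) :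
    5 ≤ #{z ∈ S | #{i ∈ M | supp i ⊆ S ∧ z ∈ supp i} = 2} := by
  set t : V → ℕ := fun z => #{i ∈ M | supp i ⊆ S ∧ z ∈ supp i} with ht
  have hle : ∀ z ∈ S, t z ≤ 2 := touch_le_two_of_seven M supp h6 h4
  have hsum : ∑ z ∈ S, t z = 12 := by
    rw [ht, sum_card_filter_mem_supp M supp hM S, h6]
  -- split the sum over the coordinates touched twice and the rest
  have hsplit := sum_filter_add_sum_filter_not S (fun z => t z = 2) t
  have hA : ∑ z ∈ S with t z = 2, t z = 2 * #{z ∈ S | t z = 2} := by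
    rw [mul_comm, ← smul_eq_mul, ← sum_const]
    exact sum_congr rfl fun z hz => (mem_filter.1 hz).2
  have hB : ∑ z ∈ S with ¬ t z = 2, t z ≤ #{z ∈ S | ¬ t z = 2} := by
    calc ∑ z ∈ S with ¬ t z = 2, t z ≤ ∑ z ∈ S with ¬ t z = 2, 1 :=
          sum_le_sum fun z hz => by
            have hz' := mem_filter.1 hz
            have := hle z hz'.1
            omega
      _ = #{z ∈ S | ¬ t z = 2} := by rw [sum_const, smul_eq_mul, mul_one]
  have hcard := card_filter_add_card_filter_not (s := S) (fun z => t z = 2)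
  rw [hS] at hcard
  have hgoal : 5 ≤ #{z ∈ S | t z = 2} := by omega
  exact hgoal

/-- **N7F §3.14, HEREDITY BOUND for the K₂ class at n = 7.** On a 7-face `S` with a distinguished edge `{a, b}` (the
hub–hub torus; the slots are the missing hub→deuce slots off the edge pair): if the co-faces omitting `a` and
omitting `b` each miss ≥ 4 slots (they are ∅-class six-faces: THEOREM HD6) and every other co-face misses ≥ 2
(HD6 §4′: a K₂-class six-face misses ≥ 2 off-edge slots), then `S` misses at least 4 slots
(`5k = Σ_z k_z ≥ 4 + 4 + 5·2 = 18`). -/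
theorem four_le_card_of_cofaces_edge (M : Finset ι) (supp : ι → Finset V)
    (hM : ∀ i ∈ M, (supp i).card = 2) {S : Finset V} (hS : S.card = 7) {a b : V} (ha : a ∈ S) (hb : b ∈ S)
    (hab : a ≠ b) (hA : 4 ≤ #{i ∈ M | supp i ⊆ S.erase a}) (hB : 4 ≤ #{i ∈ M | supp i ⊆ S.erase b})
    (h2 : ∀ z ∈ S, z ≠ a → z ≠ b → 2 ≤ #{i ∈ M | supp i ⊆ S.erase z}) : 4 ≤ #{i ∈ M | supp i ⊆ S} := by
  have hsum := sum_card_filter_supp_subset_erase M supp hM S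
  have hbS : b ∈ S.erase a := mem_erase.2 ⟨hab.symm, hb⟩
  have hrest : ((S.erase a).erase b).card * 2 ≤ ∑ z ∈ (S.erase a).erase b, #{i ∈ M | supp i ⊆ S.erase z} :=
    card_nsmul_le_sum _ _ 2 (fun z hz => by
      have hz' := mem_erase.1 hz
      have hz'' := mem_erase.1 hz'.2
      exact h2 z hz''.2 hz''.1 hz'.1) |>.trans_eq' (by rw [smul_eq_mul])
  rw [card_erase_of_mem hbS, card_erase_of_mem ha, hS] at hrest
  rw [← add_sum_erase S _ ha, ← add_sum_erase (S.erase a) _ hbS, hS] at hsum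
  omega

/-- **N7F §3.14, the equality case `k = 4` at n = 7 (K₂ class).** Under the same hypotheses, if `S` misses EXACTLY 4
slots then both edge co-faces miss exactly 4 (so no slot touches the edge: `i_a = i_b = 0`), every non-edge
coordinate lies in at most 2 slots, the five non-edge touch numbers sum to 8, and hence at least three non-edge
coordinates lie in exactly 2 slots (touch-vector (2,2,2,1,1) or (2,2,2,2,0)). -/
theorem cofaces_edge_eq_of_card_eq_four (M : Finset ι) (supp : ι → Finset V)
    (hM : ∀ i ∈ M, (supp i).card = 2) {S : Finset V} (hS : S.card = 7) {a b : V} (ha : a ∈ S) (hb : b ∈ S)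
    (hab : a ≠ b) (hA : 4 ≤ #{i ∈ M | supp i ⊆ S.erase a}) (hB : 4 ≤ #{i ∈ M | supp i ⊆ S.erase b})
    (h2 : ∀ z ∈ S, z ≠ a → z ≠ b → 2 ≤ #{i ∈ M | supp i ⊆ S.erase z}) (h4 : #{i ∈ M | supp i ⊆ S} = 4) :
    #{i ∈ M | supp i ⊆ S.erase a} = 4 ∧ #{i ∈ M | supp i ⊆ S.erase b} = 4 ∧
      (∀ z ∈ S, z ≠ a → z ≠ b → #{i ∈ M | supp i ⊆ S ∧ z ∈ supp i} ≤ 2) ∧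
      ∑ z ∈ (S.erase a).erase b, #{i ∈ M | supp i ⊆ S ∧ z ∈ supp i} = 8 ∧
      3 ≤ #{z ∈ (S.erase a).erase b | #{i ∈ M | supp i ⊆ S ∧ z ∈ supp i} = 2} := by
  -- touch numbers t_z; k_z + t_z = 4 for every coordinate z
  set t : V → ℕ := fun z => #{i ∈ M | supp i ⊆ S ∧ z ∈ supp i} with ht
  have hkt : ∀ z, #{i ∈ M | supp i ⊆ S.erase z} + t z = 4 := by
    intro z
    have hsplit := card_filter_add_card_filter_not (s := {i ∈ M | supp i ⊆ S}) (fun i => z ∈ supp i)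
    rw [filter_filter, filter_filter, h4] at hsplit
    rw [filter_supp_subset_erase, ht]
    simp only
    omega
  have hsum := sum_card_filter_supp_subset_erase M supp hM S
  have hbS : b ∈ S.erase a := mem_erase.2 ⟨hab.symm, hb⟩
  have hR : ((S.erase a).erase b).card = 5 := by rw [card_erase_of_mem hbS, card_erase_of_mem ha, hS]
  have hrest2 : ∀ z ∈ (S.erase a).erase b, 2 ≤ #{i ∈ M | supp i ⊆ S.erase z} := fun z hz => by
    have hz' := mem_erase.1 hz
    have hz'' := mem_erase.1 hz'.2
    exact h2 z hz''.2 hz''.1 hz'.1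
  have hrest : ((S.erase a).erase b).card * 2 ≤ ∑ z ∈ (S.erase a).erase b, #{i ∈ M | supp i ⊆ S.erase z} :=
    card_nsmul_le_sum _ _ 2 hrest2 |>.trans_eq' (by rw [smul_eq_mul])
  rw [hR] at hrest
  rw [← add_sum_erase S _ ha, ← add_sum_erase (S.erase a) _ hbS, hS, h4] at hsum
  have hka : #{i ∈ M | supp i ⊆ S.erase a} = 4 := by have := hkt a; omega
  have hkb : #{i ∈ M | supp i ⊆ S.erase b} = 4 := by have := hkt b; omega
  have hsumR : ∑ z ∈ (S.erase a).erase b, #{i ∈ M | supp i ⊆ S.erase z} = 12 := by omega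
  have htle : ∀ z ∈ (S.erase a).erase b, t z ≤ 2 := fun z hz => by
    have := hkt z
    have := hrest2 z hz
    omega
  have htsum : ∑ z ∈ (S.erase a).erase b, t z = 8 := by
    have h20 : ∑ z ∈ (S.erase a).erase b, (#{i ∈ M | supp i ⊆ S.erase z} + t z) =
        ∑ z ∈ (S.erase a).erase b, 4 := sum_congr rfl fun z _ => hkt z
    rw [sum_add_distrib, hsumR, sum_const, smul_eq_mul, hR] at h20
    omega
  refine ⟨hka, hkb, fun z hz hza hzb => htle z (mem_erase.2 ⟨hzb, mem_erase.2 ⟨hza, hz⟩⟩), htsum, ?_⟩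
  -- five numbers ≤ 2 summing to 8: at least three of them equal 2
  have hsplit := sum_filter_add_sum_filter_not ((S.erase a).erase b) (fun z => t z = 2) t
  have hA2 : ∑ z ∈ (S.erase a).erase b with t z = 2, t z = 2 * #{z ∈ (S.erase a).erase b | t z = 2} := by
    rw [mul_comm, ← smul_eq_mul, ← sum_const]
    exact sum_congr rfl fun z hz => (mem_filter.1 hz).2
  have hB1 : ∑ z ∈ (S.erase a).erase b with ¬ t z = 2, t z ≤ #{z ∈ (S.erase a).erase b | ¬ t z = 2} := by
    calc ∑ z ∈ (S.erase a).erase b with ¬ t z = 2, t z ≤ ∑ z ∈ (S.erase a).erase b with ¬ t z = 2, 1 :=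
          sum_le_sum fun z hz => by
            have hz' := mem_filter.1 hz
            have := htle z hz'.1
            omega
      _ = #{z ∈ (S.erase a).erase b | ¬ t z = 2} := by rw [sum_const, smul_eq_mul, mul_one]
  have hcard := card_filter_add_card_filter_not (s := (S.erase a).erase b) (fun z => t z = 2)
  rw [hR] at hcard
  have hgoal : 3 ≤ #{z ∈ (S.erase a).erase b | t z = 2} := by omega
  exact hgoal

end Summit.Ventures.HSemireg.StarFamilySlotFaceCounts
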